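import Literature.NumberTheory.NumberFields.RayClassFieldIntersection
import Literature.NumberTheory.NumberFields.RayClassFieldSplitPrimePowerDegreeQuadratic
import HarnessLib

/-!
# If `K(𝔫𝔭^{n+2})` lies in `K(𝔫𝔭^{n+1})·K(𝔣)` then `𝔭^{n+2} ∣ 𝔣` — the conductor of a ray class layer is not lowered by an auxiliary ray class field
# (Neukirch VI (6.1)–(6.2): `K(𝔞) ∩ K(𝔟) = K(gcd(𝔞,𝔟))`, `K(𝔞)K(𝔟) ⊆ K(lcm(𝔞,𝔟))`; de Shalit II.1.9: `[K(𝔫𝔭^{n+2}) : K(𝔫𝔭^{n+1})] = p`)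

Topic `NumberTheory/NumberFields`; namespace `Literature.NumberTheory.NumberFields`.  A rider to `RayClassFieldIntersection.lean` (the lattice formula
`rayClassField_inf`) and `RayClassFieldSplitPrimePowerDegree(Quadratic).lean` (the degree `p` of consecutive `𝔭`-layers).  For a number field `K`,
a prime `𝔭 = v` of degree one unramified over `p`, `𝔫 ≠ 0` prime to `𝔭` with `w_{𝔫𝔭} = 1`, and ANY non-zero `𝔣`:

* ★★ `le_pow_of_rayClassField_le_sup` — **`K(𝔫𝔭^{n+2}) ≤ K(𝔫𝔭^{n+1}) ⊔ K(𝔣) ⟹ 𝔣 ≤ 𝔭^{n+2}`** (i.e. `𝔭^{n+2} ∣ 𝔣`).  Proof: write `𝔣 = 𝔭^j 𝔣₀` with `𝔭 ∤ 𝔣₀`;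
  if `j ≤ n+1` then `gcd(lcm(𝔫𝔭^{n+1}, 𝔣), 𝔫𝔭^{n+2}) ⊇ 𝔫𝔭^{n+1}𝔣₀ + 𝔫𝔭^{n+2} = 𝔫𝔭^{n+1}(𝔣₀ + 𝔭) = 𝔫𝔭^{n+1}`, so
  `K(𝔫𝔭^{n+2}) ≤ K(lcm) ∩ K(𝔫𝔭^{n+2}) = K(gcd) ≤ K(𝔫𝔭^{n+1})`, contradicting `[K(𝔫𝔭^{n+2}) : K(𝔫𝔭^{n+1})] = p > 1`.
* ★ `le_pow_and_le_pow_of_rayClassField_two_primes_le_sup` — the two-prime form along the symmetric towers of the tree's cell `bsd-print-cf2`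
  (`K` imaginary quadratic, `p = v v̄` split, `S_m = K(𝔤₀ v̄^ν v̄^{m+1} v^{m+ν+1})`): `S_{m+1} ≤ S_m ⊔ K(𝔣) ⟹ 𝔣 ≤ v^{m+ν+2} ∧ 𝔣 ≤ v̄^{ν+m+2}` — the
  auxiliary conductor of a Rubin generator of `S_{m+1}` whose norm to `S_m` is NOT a `p`-th power is divisible by the full `v`- and `v̄`-powers
  (the «`e = 1 ⟹ full conductor`» input of the depletion step of brick (c), de Shalit III §1.3–1.4).
THEOREMS ONLY (no definition, no named fact, no `sorry`, no instance).

## References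
* [NeukirchANT1999] J. Neukirch, *Algebraic Number Theory* (1999), Ch. VI §6 Thm. (6.1) (p. 395), Def. (6.2) (p. 397) (ray class fields, `𝒩_{L₁∩L₂} = 𝒩_{L₁}𝒩_{L₂}`).
* [deShalit1987] E. de Shalit, *Iwasawa theory of elliptic curves with complex multiplication* (1987), II.1.9 (p. 43) (`[K(𝔣𝔭^{n+1}) : K(𝔣𝔭)] = p^n`),
  III §1.3–1.4 (p. 88–91).
-/

noncomputable section

open scoped Classical
open NumberField IsDedekindDomain IsDedekindDomain.HeightOneSpectrum IntermediateField Module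

namespace Literature.NumberTheory.NumberFields

variable {K : Type} [Field K] [NumberField K]

/-! ### §1. One prime -/

/-- Ideal bookkeeping: for `𝔣 = 𝔭^j·𝔣₀` with `𝔭 ∤ 𝔣₀` and `j ≤ n+1`, `𝔫𝔭^{n+1} ≤ (𝔫𝔭^{n+1} ⊓ 𝔣) ⊔ 𝔫𝔭^{n+1}𝔭`
(`gcd(lcm(𝔫𝔭^{n+1}, 𝔣), 𝔫𝔭^{n+2}) ∣ 𝔫𝔭^{n+1}`). [cite: NeukirchANT1999, Ch. VI §6 Thm. (6.1) (p. 395)] -/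
theorem mul_pow_le_inf_sup_mul_pow_succ (v : HeightOneSpectrum (𝓞 K)) (𝔫 𝔣₀ : Ideal (𝓞 K)) (h𝔣₀ : ¬ 𝔣₀ ≤ v.asIdeal) {j n : ℕ}
    (hj : j ≤ n + 1) :
    𝔫 * v.asIdeal ^ (n + 1) ≤ (𝔫 * v.asIdeal ^ (n + 1) ⊓ (v.asIdeal ^ j * 𝔣₀)) ⊔ 𝔫 * v.asIdeal ^ (n + 1) * v.asIdeal := by
  -- `𝔫𝔭^{n+1}·𝔣₀ ≤ 𝔫𝔭^{n+1} ⊓ 𝔭^j𝔣₀`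
  have h1 : 𝔫 * v.asIdeal ^ (n + 1) * 𝔣₀ ≤ 𝔫 * v.asIdeal ^ (n + 1) ⊓ (v.asIdeal ^ j * 𝔣₀) := by
    refine le_inf Ideal.mul_le_right ?_
    calc 𝔫 * v.asIdeal ^ (n + 1) * 𝔣₀ ≤ v.asIdeal ^ (n + 1) * 𝔣₀ := Ideal.mul_mono_left Ideal.mul_le_left
      _ ≤ v.asIdeal ^ j * 𝔣₀ := Ideal.mul_mono_left (Ideal.pow_le_pow_right hj)
  -- `𝔣₀ + 𝔭 = 1`
  have htop : 𝔣₀ ⊔ v.asIdeal = ⊤ := by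
    have hlt : v.asIdeal < 𝔣₀ ⊔ v.asIdeal := lt_of_le_of_ne le_sup_right fun h ↦ h𝔣₀ (h ▸ le_sup_left)
    exact v.isMaximal.1.2 _ hlt
  calc 𝔫 * v.asIdeal ^ (n + 1) = 𝔫 * v.asIdeal ^ (n + 1) * (𝔣₀ ⊔ v.asIdeal) := by rw [htop, Ideal.mul_top]
    _ = 𝔫 * v.asIdeal ^ (n + 1) * 𝔣₀ ⊔ 𝔫 * v.asIdeal ^ (n + 1) * v.asIdeal := Ideal.mul_sup _ _ _
    _ ≤ (𝔫 * v.asIdeal ^ (n + 1) ⊓ (v.asIdeal ^ j * 𝔣₀)) ⊔ 𝔫 * v.asIdeal ^ (n + 1) * v.asIdeal := sup_le_sup_right h1 _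

section OnePrime

variable [IsTotallyComplex K] (v : HeightOneSpectrum (𝓞 K)) {p : ℕ} [Fact p.Prime]
  (hdeg : Nat.card (𝓞 K ⧸ v.asIdeal) = p)
  (hval : v.intValuation ((p : ℕ) : 𝓞 K) = WithZero.exp (-1 : ℤ))
  {𝔫 : Ideal (𝓞 K)} (h𝔫 : 𝔫 ≠ ⊥) (hcop : IsCoprime 𝔫 v.asIdeal)
  (hw : ∀ u : (𝓞 K)ˣ, (u : 𝓞 K) - 1 ∈ 𝔫 * v.asIdeal → u = 1)
include hdeg hval h𝔫 hcop hw

/-- ★★ **`K(𝔫𝔭^{n+2}) ≤ K(𝔫𝔭^{n+1}) ⊔ K(𝔣) ⟹ 𝔭^{n+2} ∣ 𝔣`** (`K` totally complex, `𝔭` of degree one unramified over `p`, `𝔫 ≠ 0` prime to `𝔭`,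
`w_{𝔫𝔭} = 1`, `𝔣 ≠ 0`): otherwise `K(𝔫𝔭^{n+2}) ≤ K(lcm(𝔫𝔭^{n+1},𝔣)) ∩ K(𝔫𝔭^{n+2}) = K(gcd) ≤ K(𝔫𝔭^{n+1})`, against `[K(𝔫𝔭^{n+2}) : K(𝔫𝔭^{n+1})] = p`.
[cite: NeukirchANT1999, Ch. VI §6 Thm. (6.1) (p. 395), Def. (6.2) (p. 397)] [cite: deShalit1987, II.1.9 (p. 43)] -/
theorem le_pow_of_rayClassField_le_sup {𝔣 : Ideal (𝓞 K)} (h𝔣 : 𝔣 ≠ ⊥) (n : ℕ)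
    (h : rayClassField K (𝔫 * v.asIdeal ^ (n + 2)) ≤ rayClassField K (𝔫 * v.asIdeal ^ (n + 1)) ⊔ rayClassField K 𝔣) :
    𝔣 ≤ v.asIdeal ^ (n + 2) := by
  by_contra hnot
  -- `𝔣 = 𝔭^j 𝔣₀`, `𝔭 ∤ 𝔣₀`, and `j ≤ n+1`
  have hirr : Irreducible v.asIdeal := (Ideal.prime_of_isPrime v.ne_bot v.isPrime).irreducible
  obtain ⟨j, 𝔣₀, hndvd, hfac⟩ := WfDvdMonoid.max_power_factor h𝔣 hirr
  have h𝔣₀ : ¬ 𝔣₀ ≤ v.asIdeal := fun hle ↦ hndvd (Ideal.dvd_iff_le.mpr hle)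
  have hj : j ≤ n + 1 := by
    by_contra hj
    apply hnot
    rw [hfac]
    exact Ideal.mul_le_right.trans (Ideal.pow_le_pow_right (by omega))
  -- the moduli
  set 𝔪 : Ideal (𝓞 K) := 𝔫 * v.asIdeal ^ (n + 1) with h𝔪def
  have h𝔪0 : 𝔪 ≠ ⊥ := mul_ne_zero h𝔫 (pow_ne_zero _ v.ne_bot)
  have h𝔪v : 𝔫 * v.asIdeal ^ (n + 2) = 𝔪 * v.asIdeal := by rw [h𝔪def, pow_succ, mul_assoc]
  have hinf0 : 𝔪 ⊓ 𝔣 ≠ ⊥ := by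
    intro h0
    have : 𝔪 * 𝔣 = ⊥ := le_bot_iff.mp (h0 ▸ Ideal.mul_le_inf)
    exact (mul_ne_zero h𝔪0 h𝔣) this
  -- `K(𝔪) ⊔ K(𝔣) ≤ K(𝔪 ⊓ 𝔣)` hence `K(𝔪𝔭) ≤ K(𝔪 ⊓ 𝔣) ⊓ K(𝔪𝔭) = K((𝔪 ⊓ 𝔣) ⊔ 𝔪𝔭)`
  have h1 : rayClassField K 𝔪 ⊔ rayClassField K 𝔣 ≤ rayClassField K (𝔪 ⊓ 𝔣) :=
    sup_le (rayClassField_le_of_le hinf0 inf_le_left) (rayClassField_le_of_le hinf0 inf_le_right)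
  have h2 : rayClassField K (𝔪 * v.asIdeal) ≤ rayClassField K ((𝔪 ⊓ 𝔣) ⊔ 𝔪 * v.asIdeal) := by
    rw [← rayClassField_inf hinf0 (mul_ne_zero h𝔪0 v.ne_bot)]
    exact le_inf (h𝔪v ▸ h |>.trans h1) le_rfl
  -- `(𝔪 ⊓ 𝔣) ⊔ 𝔪𝔭 ⊇ 𝔪`, so `K((𝔪 ⊓ 𝔣) ⊔ 𝔪𝔭) ≤ K(𝔪)`
  have h3 : 𝔪 ≤ (𝔪 ⊓ 𝔣) ⊔ 𝔪 * v.asIdeal := by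
    have := mul_pow_le_inf_sup_mul_pow_succ v 𝔫 𝔣₀ h𝔣₀ hj (n := n)
    rw [← hfac] at this
    exact this
  have h4 : rayClassField K ((𝔪 ⊓ 𝔣) ⊔ 𝔪 * v.asIdeal) ≤ rayClassField K 𝔪 := rayClassField_le_of_le h𝔪0 h3
  have h5 : rayClassField K (𝔫 * v.asIdeal ^ (n + 2)) ≤ rayClassField K (𝔫 * v.asIdeal ^ (n + 1)) := by
    rw [h𝔪v]; exact h2.trans h4
  -- contradiction with the degree `p`
  have hone : IntermediateField.relfinrank (rayClassField K (𝔫 * v.asIdeal ^ (n + 1))) (rayClassField K (𝔫 * v.asIdeal ^ (n + 2))) = 1 :=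
    IntermediateField.relfinrank_eq_one_iff.mpr h5
  rw [relfinrank_rayClassField_mul_pow_succ_succ v hdeg hval h𝔫 hcop hw n] at hone
  exact (Fact.out : p.Prime).one_lt.ne' hone

end OnePrime

/-! ### §2. Two primes: the symmetric tower `S_m = K(𝔤₀ v̄^ν v̄^{m+1} v^{m+ν+1})` -/

section TwoPrimes

open Literature.NumberTheory.EllipticCurves

variable {𝔤₀ : Ideal (𝓞 K)} {v v' : HeightOneSpectrum (𝓞 K)}

/-- ★ **`S_{m+1} ≤ S_m ⊔ K(𝔣) ⟹ 𝔣 ≤ v^{m+ν+2} ∧ 𝔣 ≤ v̄^{ν+m+2}`** for the symmetric ray class towers `S_m = K(𝔤₀ v̄^ν v̄^{m+1} v^{m+ν+1})` of an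
imaginary quadratic `K` in which `p = v v̄` splits (`v̄ ≠ v`), `𝔤₀ ≠ 0` prime to `v`, `v̄` with `w_{𝔤₀} = 1`, and any `𝔣 ≠ 0`: the auxiliary conductor of a
Rubin generator of `S_{m+1}` surviving the norm to `S_m` (`[S_{m+1}K(𝔣) : S_mK(𝔣)] = 1`) carries the full `v`- and `v̄`-powers.
[cite: deShalit1987, II.1.9 (p. 43), III §1.3–1.4 (p. 88–91)] [cite: NeukirchANT1999, Ch. VI §6 Thm. (6.1) (p. 395)] -/
theorem le_pow_and_le_pow_of_rayClassField_two_primes_le_sup (hK : IsImaginaryQuadratic K) {p : ℕ} [hp : Fact p.Prime]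
    (hpv : (p : 𝓞 K) ∈ v.asIdeal) (hpv' : (p : 𝓞 K) ∈ v'.asIdeal) (hvv' : v' ≠ v)
    (h𝔤0 : 𝔤₀ ≠ ⊥) (hv : ¬ 𝔤₀ ≤ v.asIdeal) (hv' : ¬ 𝔤₀ ≤ v'.asIdeal) (hw𝔤 : ∀ u : (𝓞 K)ˣ, (u : 𝓞 K) - 1 ∈ 𝔤₀ → u = 1)
    (ν m : ℕ) {𝔣 : Ideal (𝓞 K)} (h𝔣 : 𝔣 ≠ ⊥)
    (h : rayClassField K (𝔤₀ * v'.asIdeal ^ ν * v'.asIdeal ^ (m + 2) * v.asIdeal ^ (m + ν + 2)) ≤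
      rayClassField K (𝔤₀ * v'.asIdeal ^ ν * v'.asIdeal ^ (m + 1) * v.asIdeal ^ (m + ν + 1)) ⊔ rayClassField K 𝔣) :
    𝔣 ≤ v.asIdeal ^ (m + ν + 2) ∧ 𝔣 ≤ v'.asIdeal ^ (ν + m + 2) := by
  haveI := hK.isTotallyComplex
  have hpv1 : ((p : ℕ) : 𝓞 K) ∈ v.asIdeal := by exact_mod_cast hpv
  have hpv1' : ((p : ℕ) : 𝓞 K) ∈ v'.asIdeal := by exact_mod_cast hpv'
  have hdegv := natCard_quotient_eq_of_mem_of_mem_of_ne hK.1 hp.out hpv1 hpv1' hvv'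
  have hvalv := intValuation_natCast_eq_of_mem_of_mem_of_ne hK.1 hp.out hpv1 hpv1' hvv'
  have hdegv' := natCard_quotient_eq_of_mem_of_mem_of_ne hK.1 hp.out hpv1' hpv1 hvv'.symm
  have hvalv' := intValuation_natCast_eq_of_mem_of_mem_of_ne hK.1 hp.out hpv1' hpv1 hvv'.symm
  -- coprimality bookkeeping
  have hcv : IsCoprime 𝔤₀ v.asIdeal := (Ideal.isCoprime_iff_sup_eq.mpr
    (v.isMaximal.1.2 _ (lt_of_le_of_ne le_sup_right fun e ↦ hv (e ▸ le_sup_left))))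
  have hcv' : IsCoprime 𝔤₀ v'.asIdeal := (Ideal.isCoprime_iff_sup_eq.mpr
    (v'.isMaximal.1.2 _ (lt_of_le_of_ne le_sup_right fun e ↦ hv' (e ▸ le_sup_left))))
  have hvv'c : IsCoprime v'.asIdeal v.asIdeal := by
    rw [Ideal.isCoprime_iff_sup_eq]
    exact v'.isMaximal.coprime_of_ne v.isMaximal fun e ↦ hvv' (HeightOneSpectrum.ext e)
  -- the bigger field contains the two one-step layers
  have hbig0 : 𝔤₀ * v'.asIdeal ^ ν * v'.asIdeal ^ (m + 2) * v.asIdeal ^ (m + ν + 2) ≠ ⊥ :=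
    mul_ne_zero (mul_ne_zero (mul_ne_zero h𝔤0 (pow_ne_zero _ v'.ne_bot)) (pow_ne_zero _ v'.ne_bot)) (pow_ne_zero _ v.ne_bot)
  constructor
  · -- the `v`-direction: `𝔫 = 𝔤₀ v'^ν v'^{m+1}`, `n = m + ν`
    have e1 : 𝔤₀ * v'.asIdeal ^ ν * v'.asIdeal ^ (m + 1) * v.asIdeal ^ (m + ν + 1) = (𝔤₀ * v'.asIdeal ^ ν * v'.asIdeal ^ (m + 1)) * v.asIdeal ^ (m + ν + 1) := rfl
    have hstep : rayClassField K ((𝔤₀ * v'.asIdeal ^ ν * v'.asIdeal ^ (m + 1)) * v.asIdeal ^ (m + ν + 2)) ≤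
        rayClassField K (𝔤₀ * v'.asIdeal ^ ν * v'.asIdeal ^ (m + 2) * v.asIdeal ^ (m + ν + 2)) :=
      rayClassField_le_of_le hbig0 (Ideal.mul_mono_left (Ideal.mul_mono_right (Ideal.pow_le_pow_right (Nat.le_succ _))))
    have h𝔫 : 𝔤₀ * v'.asIdeal ^ ν * v'.asIdeal ^ (m + 1) ≠ ⊥ :=
      mul_ne_zero (mul_ne_zero h𝔤0 (pow_ne_zero _ v'.ne_bot)) (pow_ne_zero _ v'.ne_bot)
    have hcop : IsCoprime (𝔤₀ * v'.asIdeal ^ ν * v'.asIdeal ^ (m + 1)) v.asIdeal :=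
      (hcv.mul_left (IsCoprime.pow_left hvv'c)).mul_left (IsCoprime.pow_left hvv'c)
    have hw : ∀ u : (𝓞 K)ˣ, (u : 𝓞 K) - 1 ∈ 𝔤₀ * v'.asIdeal ^ ν * v'.asIdeal ^ (m + 1) * v.asIdeal → u = 1 :=
      fun u hu ↦ hw𝔤 u ((Ideal.mul_le_right.trans (Ideal.mul_le_right.trans Ideal.mul_le_right)) hu)
    exact le_pow_of_rayClassField_le_sup v hdegv hvalv h𝔫 hcop hw h𝔣 (m + ν) (hstep.trans h)
  · -- the `v̄`-direction: `𝔫' = 𝔤₀ v^{m+ν+1}`, `n = ν + m`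
    have e2 : 𝔤₀ * v'.asIdeal ^ ν * v'.asIdeal ^ (m + 1) * v.asIdeal ^ (m + ν + 1) = (𝔤₀ * v.asIdeal ^ (m + ν + 1)) * v'.asIdeal ^ (ν + m + 1) := by
      rw [show ν + m + 1 = ν + (m + 1) by ring, pow_add]; ring
    have e3 : 𝔤₀ * v'.asIdeal ^ ν * v'.asIdeal ^ (m + 2) * v.asIdeal ^ (m + ν + 2) ≤ (𝔤₀ * v.asIdeal ^ (m + ν + 1)) * v'.asIdeal ^ (ν + m + 2) := by
      have e4 : (𝔤₀ * v.asIdeal ^ (m + ν + 1)) * v'.asIdeal ^ (ν + m + 2) = 𝔤₀ * v'.asIdeal ^ ν * v'.asIdeal ^ (m + 2) * v.asIdeal ^ (m + ν + 1) := by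
        rw [show ν + m + 2 = ν + (m + 2) by ring, pow_add]; ring
      rw [e4]
      exact Ideal.mul_mono_right (Ideal.pow_le_pow_right (Nat.le_succ _))
    have hstep : rayClassField K ((𝔤₀ * v.asIdeal ^ (m + ν + 1)) * v'.asIdeal ^ (ν + m + 2)) ≤
        rayClassField K (𝔤₀ * v'.asIdeal ^ ν * v'.asIdeal ^ (m + 2) * v.asIdeal ^ (m + ν + 2)) :=
      rayClassField_le_of_le hbig0 e3
    have h𝔫 : 𝔤₀ * v.asIdeal ^ (m + ν + 1) ≠ ⊥ := mul_ne_zero h𝔤0 (pow_ne_zero _ v.ne_bot)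
    have hcop : IsCoprime (𝔤₀ * v.asIdeal ^ (m + ν + 1)) v'.asIdeal := hcv'.mul_left (IsCoprime.pow_left hvv'c.symm)
    have hw : ∀ u : (𝓞 K)ˣ, (u : 𝓞 K) - 1 ∈ 𝔤₀ * v.asIdeal ^ (m + ν + 1) * v'.asIdeal → u = 1 :=
      fun u hu ↦ hw𝔤 u ((Ideal.mul_le_right.trans Ideal.mul_le_right) hu)
    have h' := hstep.trans h
    rw [e2] at h'
    exact le_pow_of_rayClassField_le_sup v' hdegv' hvalv' h𝔫 hcop hw h𝔣 (ν + m) h'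

end TwoPrimes

end Literature.NumberTheory.NumberFields

end
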